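import Summits.HodgeConjecture.HodgeConjecture.Theorems.F0P3cStCharTSSaRegroup           -- ★ p848976 (R) «Sa-REGROUP★» (LH6-p01 g0): `sa_regroup_of_carpet` — print's (12.7.1) at the organ's binders
import Summits.HodgeConjecture.HodgeConjecture.Theorems.F0P3cStCharTSSaCompose           -- ★ p848625 «Sa-COMPOSE★» (LH6-p05): `stSupportFinite_of_members_isL2_at_organ` — (S-a).1 from (S-a).2
import Summits.HodgeConjecture.HodgeConjecture.Theorems.F0P3cStCharTSUpPseudo            -- ★ p848578 K1b «UP-PSEUDO» (LH6-p05): `packetTrace_transfer_eq_innerG_up`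
import Summits.HodgeConjecture.HodgeConjecture.Theorems.F0P3cStCharTSScFin               -- ★ «L2-FIN» (LH6-p05): `finite_isL2_innerG_ne_zero`
import Summits.HodgeConjecture.HodgeConjecture.Theorems.F0P3cStCharTSFinOfL2             -- ★ p848594 (LH6-p05): `not_isL2_of_isEllipticPair` ((PAIRS-ONE-L2) from (DET)(PIN)(LDS))
import Summits.HodgeConjecture.HodgeConjecture.Theorems.F0P3cStCharTSSaTorusNZ           -- ★ p849140 F3′ «Sa-TORUS★» (LH6-p05): `false_of_saRegroup_disjunct_of_ne_zero` — (F) with (SHF≠0), discharges §1's `hF` (ED. 2)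
import Summits.HodgeConjecture.HodgeConjecture.Theorems.F0P3bLocalNonsplitCompactCenter   -- ★ compact centre of `U(Φ₃)(L⁺_v)` at a non-split `v` ((SC-L2) discharge)
import Literature.NumberTheory.Rogawski1990.SupercuspidalNotSphericalCofinite            -- ★ `IrrClass.isSquareIntegrable_of_isSupercuspidal_of_isCompact_center`
import Literature.NumberTheory.Automorphic.LocalUnitaryGroupCenter                       -- ★ `forall_mem_center_cmLocal_eq_scalar`
import Literature.NumberTheory.Automorphic.LocalUnitaryGroupCongr                        -- ★ `antidiagOne_isHermitian`, `isUnit_antidiagOne_det`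
import Literature.NumberTheory.Rogawski1990.Ch12Sec5                                     -- ★ TR carpet relations
import Literature.NumberTheory.Rogawski1990.Ch12Sec6
import Literature.NumberTheory.Rogawski1990.CMCharIdentityClauses                        -- ★ organ vocabulary (`OneDimAutRepH`, `Gqs`, `qsForm`, `charDist`, …)
import Literature.NumberTheory.Rogawski1990.LocalTransferExistence                        -- ★ `IsLocalDeltaTransferExists` ((T_v)), `IsLocalDeltaTransfer`
import Literature.NumberTheory.Rogawski1990.FinExplicitTransferFactorConjRight            -- ★ the Δ‴_{Φ₃} of record
import Literature.NumberTheory.Automorphic.OrbitalMeasureCanonical                        -- ★ `OrbitalMeasureFamily.IsCanonical`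
import Literature.NumberTheory.Automorphic.UnitaryGroupPrincipalSeriesH                   -- ★ `HLengthTwoLabels`
import Literature.NumberTheory.Automorphic.IrreducibleClassesUnitarizable                 -- ★ `IrrClass.IsUnitarizable`, `IrrClass.IsSquareIntegrable`
import Literature.NumberTheory.Automorphic.UnitaryGroupPrincipalSeriesExponents           -- ★ `cmTorusCharPair`, `conjInvChar` (the PAIR currency and `W`)
import Literature.NumberTheory.Automorphic.UnitaryGroupBorelInduction                     -- ★ `cmPrincipalSeries`, `normOneUnits`
import HarnessLib

/-!
# F0 · P3c · line LH6 «StCharTS» — «Sa-HEAD★»: THE (S-a) ORGAN `stub_StSupportFiniteSqInt` AS A THEOREM OF THE §12.5–12.6 DATUM, THE TR CARPETS AND NAMED SOCKETS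
# [Rogawski1990, Lemma 12.7.2, first half of the proof pp. 191–194]: «the support of `aX` is FINITE and consists of SQUARE-INTEGRABLE classes»

Cell `pub/hodgecm-mathlib`, crux H413 = `stmt-HodgeConjecture-24833` (`--supports` lane, helper), route HCCMUnconditional; seat LH6-p01 (g2); desk F0P3b-plan (g23) DEAL
«Sa-HEAD★» 2026-09-02T04:17:15Z.  THEOREMS ONLY, sorry-free, no definition ∕ instance ∕ notation ∕ named fact ∕ `Lines` import; the §12.5 datum `𝔇`, the parameter map
`par`, the split-torus data (`μM`, `M_c`, `a`, `F_f`, `Ω`, `toC`) are BINDERS; nothing about `U(3)` is asserted beyond the organ's own hypotheses.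
HONEST LABEL: HC_CM is proved only modulo the 7 printed citations (2 remaining: hLiu418 = stmt-HodgeConjecture-24832, h413 = stmt-HodgeConjecture-24833) until rung 0
closes; count-neutral, hypothesis-fed — (S-a) stays a printed row of the leaf `Cruxes/H413/Lines/F0_P3c_StCharTSPaydown.lean` ED. 2 (:166) until the desk's ED. 3 binds
this head (then (S-a) is a theorem in-leaf modulo the extended package (S-𝔇)).

THE STATEMENT: binders = (A) the TREE TEXT of `stub_StSupportFiniteSqInt` (leaf ED. 2 :167–:191, `Pl`∕`HLoc` unfolded; byte-identical with the prefix of ★ (R) p848976 and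
★ «Sa-COMPOSE» p848625, copied by script from those tree files) up to and including the `μZ` binders; (B) the §12.5–12.6 DATUM `𝔇 : EllipticData (U(Φ₃)(L⁺_v)) (H_v)` +
COMPAT (★ p848567 block, byte-copied); (C) CARPET relations = the union of ★ p848625's and ★ p848976's (`WeylIntegrationFormula`, `UpSpec`, `PseudoCoeffExists`,
`PseudoCoeffTrace`, `Prop1261a∕b∕c`, `LdsCharactersOpposite`, `EllipticOfNotPrincipalSeries`, `EllipticClassification`); (D) SOCKETS = the union of ★ p848625's
((M1H)(UPR)(ELL)(DET)(PIN)(LDS)(L2D∀)(U2)(C1)(C2)(C3), byte-copied) and ★ p848976's remaining datum-level ones ((LDSE)(LDSU)(LDS2)(R0)(MATE-UNIQ)(ST-L2)(PI2-L2),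
byte-copied) and its principal-series block at the binder `par` ((PS1)(PS2)(PS3=JHL)(NONL2-PAR)(UNIQ-PAR), byte-copied); (E) the split-torus block of LH6-p05's ★ (F)
«Sa-TORUS★» p849030 ((PSE), (TOR), `F_f`, `Ω`, `toC`, (WM∕L2M), (HM), (PSM), (SHF)) with the ONLY changes that its `b`∕`d`-restricted clauses are asked for EVERY
square-integrable class `σ` ∕ EVERY CONTINUOUS parameter `χ` (the disjunct's `b`, `d` are not binders here — (R) produces them inside the proof, with `supp b` square-
integrable and `supp d` continuous), and (SHF) is asked on the shells `n ≠ 0` ONLY (print supplies it there and only there: [L. 12.7.1 proof p. 191] «`f ∈ S`», `m`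
non-zero — LH6-p05's self-box 04:16Z; the unit shell is junk); (F) — in the binder form `stSupportFiniteSqInt_of_carpet_of_F`, INSTEAD of the block (E) — the statement «the second disjunct of (R) is
impossible» AS A BINDER `hF` (its antecedents = the clauses ★ p849030 consumes, byte-copied), standing in BY NAME for LH6-p05's organ-level ★ with (SHF≠0) until it
lands; (G) the organ's OWN binders `aX`, countable support, unitarizable members, the (β)-identity — VERBATIM; conclusion = the organ's, VERBATIM.
DISCHARGED INSIDE (not sockets): «UP-PSEUDO» at `x := 𝔇.up (𝔇.packetCharH {πSt})` (★ K1b `packetTrace_transfer_eq_innerG_up` from ★ `WeylIntegrationFormula` + ★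
`UpSpec` + (M1H)(UPR)(L2D∀)(C1)(C2)(C3)); «FIN» `{σ L² ∣ ⟨x, χ_σ⟩_e ≠ 0}` finite (★ `F0P3cStCharTSScFin.finite_isL2_innerG_ne_zero`, Bessel over the orthonormal
square-integrable characters, integrality of the coefficients); (PAIRS-ONE-L2) (★ `not_isL2_of_isEllipticPair` from (DET)(PIN)(LDS)); (SC-L2) «supercuspidal ⇒
square-integrable modulo the centre» (★ `IrrClass.isSquareIntegrable_of_isSupercuspidal_of_isCompact_center` + the COMPACT CENTRE of `U(Φ₃)(L⁺_v)` at the non-split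
`v`: ★ `F0P3bLocalNonsplitCompactCenter.local_nonsplit_compactOpen_center_of_center_le` + ★ `forall_mem_center_cmLocal_eq_scalar`).
PROOF: (S-a).2 «every member square-integrable» by cases on ★ (R) `sa_regroup_of_carpet`: first disjunct = done; second disjunct ⇒ `False` by (F) (fed the ∀-forms
of (WM)(PSM)(SHF≠0)(PSE) through the disjunct's own «`supp b` square-integrable» and (CONT)); then (S-a).1 «finite» by ★ `stSupportFinite_of_members_isL2_at_organ`.
Print: [Rogawski1990, L. 12.7.2 proof pp. 191–194]: `X = X′ ⊔ X″ ⊔ X‴`; (12.7.1) regroups the identity; the split-torus Fourier argument kills the principal-series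
part (`X‴ = ∅`, `a(π^{nt}) = 0`); pseudo-coefficients + orthogonality + Bessel make `X″` finite.

ED. 2 (LH6-p05 (g0), §2): **`stSupportFiniteSqInt_of_carpet`** — §1 with the binder `hF` DISCHARGED by ★ F3′ `F0P3cStCharTSSaTorusNZ.false_of_saRegroup_disjunct_of_ne_zero`
(p849140); in its place the split-torus sockets (PSE)(TOR)(WM∕L2M)(HM)(PSM)(SHF≠0) in ∀-form (every square-integrable class ∕ every continuous pair). §1 byte-identical.
## References
* [Rogawski1990] J. D. Rogawski, *Automorphic Representations of Unitary Groups in Three Variables*, Ann. of Math. Stud. 123 (1990): §12.7 Lemma 12.7.1 (proof)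
  p. 191, Lemma 12.7.2 (proof) pp. 191–194 ((12.7.1) p. 192); §12.6 p. 187, Prop. 12.6.1 p. 188; §12.5 pp. 182–184; §12.2 pp. 173–174; §12.1 p. 171.
* [HarishChandra1970] Harish-Chandra, *Harmonic analysis on reductive p-adic groups*, LNM 162 (1970): Part I §3 (supercuspidal ⇒ compactly supported
  matrix coefficients modulo the centre).
-/

set_option autoImplicit false
-- the mandated namespace has the single-problem summit's repeated segment (`HodgeConjecture.HodgeConjecture`)
set_option linter.dupNamespace false

noncomputable section

open NumberField IsDedekindDomain MeasureTheory MeasureTheory.Measure Filter Topology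
open scoped Matrix MatrixGroups BigOperators
open Literature.NumberTheory.Rogawski1990 Literature.NumberTheory.Automorphic Literature.NumberTheory.Automorphic.UnitaryGroup
open Literature.NumberTheory.GaloisRepresentations

namespace Summit.HodgeConjecture.HodgeConjecture.Cruxes.H413.F0P3cStCharTSSaHead

open Literature.NumberTheory.Rogawski1990.Ch12Sec5

/-! ## §1 «Sa-HEAD★» with (F) as a binder -/

set_option maxHeartbeats 1600000 in
-- the statement alone (≈ 230 lines of binders: organ prefix + datum block + ≈ 45 sockets) exceeds the default budget; the proof is short
/-- **«Sa-HEAD★» (binder form) — organ (S-a) `stub_StSupportFiniteSqInt` from the §12.5–12.6 datum, the TR carpets, the named sockets, and (F) «the second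
disjunct of (R) is impossible» as the binder `hF`.**  See the module docstring for the census of every antecedent and the proof.
[cite: Rogawski1990, §12.7 Lemma 12.7.2 (proof) pp. 191–194; Lemma 12.7.1 (proof) p. 191; §12.6 Prop. 12.6.1 p. 188; §12.5 pp. 182–184; §12.2 pp. 173–174] -/
theorem stSupportFiniteSqInt_of_carpet_of_F :
  ∀ (L : Type) [Field L] [NumberField L] [IsCMField L] (μ : HeckeCharacter L) (ξ : OneDimAutRepH L) (v : HeightOneSpectrum (𝓞 ↥(maximalRealSubfield L))),
    (∀ w : PlacesOver L v, IsCMField.complexConj L • w.1 = w.1) → μ.IsUnitary →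
    (∀ x : Literature.NumberTheory.GaloisRepresentations.ideleGroup ↥(maximalRealSubfield L),
      μ (AdeleRing.ideleBaseChange (↥(maximalRealSubfield L)) L x) = quadraticHeckeCharCM L x) →
    ∀ [MeasurableSpace ((UnitaryGroup.cmDatum L 2 (Matrix.of fun i j : Fin 2 => if i.val + j.val + 1 = 2 then (1 : L) else 0)).Local v × (UnitaryGroup.cmDatum L 1 (Matrix.of fun i j : Fin 1 => if i.val + j.val + 1 = 1 then (1 : L) else 0)).Local v)] [BorelSpace ((UnitaryGroup.cmDatum L 2 (Matrix.of fun i j : Fin 2 => if i.val + j.val + 1 = 2 then (1 : L) else 0)).Local v × (UnitaryGroup.cmDatum L 1 (Matrix.of fun i j : Fin 1 => if i.val + j.val + 1 = 1 then (1 : L) else 0)).Local v)] [MeasurableSpace (Gqs L v)] [BorelSpace (Gqs L v)]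
      (νHv : Measure ((UnitaryGroup.cmDatum L 2 (Matrix.of fun i j : Fin 2 => if i.val + j.val + 1 = 2 then (1 : L) else 0)).Local v × (UnitaryGroup.cmDatum L 1 (Matrix.of fun i j : Fin 1 => if i.val + j.val + 1 = 1 then (1 : L) else 0)).Local v)) (νQv : Measure (Gqs L v))
      [νHv.IsHaarMeasure] [νHv.IsMulRightInvariant] [νQv.IsHaarMeasure] [νQv.IsMulRightInvariant],
    letI : ∀ a : ((UnitaryGroup.cmDatum L 2 (Matrix.of fun i j : Fin 2 => if i.val + j.val + 1 = 2 then (1 : L) else 0)).Local v × (UnitaryGroup.cmDatum L 1 (Matrix.of fun i j : Fin 1 => if i.val + j.val + 1 = 1 then (1 : L) else 0)).Local v), MeasurableSpace (((UnitaryGroup.cmDatum L 2 (Matrix.of fun i j : Fin 2 => if i.val + j.val + 1 = 2 then (1 : L) else 0)).Local v × (UnitaryGroup.cmDatum L 1 (Matrix.of fun i j : Fin 1 => if i.val + j.val + 1 = 1 then (1 : L) else 0)).Local v) ⧸ Subgroup.centralizer ({a} : Set ((UnitaryGroup.cmDatum L 2 (Matrix.of fun i j : Fin 2 => if i.val + j.val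 + 1 = 2 then (1 : L) else 0)).Local v × (UnitaryGroup.cmDatum L 1 (Matrix.of fun i j : Fin 1 => if i.val + j.val + 1 = 1 then (1 : L) else 0)).Local v))) := fun _ => borel _
    haveI : ∀ a : ((UnitaryGroup.cmDatum L 2 (Matrix.of fun i j : Fin 2 => if i.val + j.val + 1 = 2 then (1 : L) else 0)).Local v × (UnitaryGroup.cmDatum L 1 (Matrix.of fun i j : Fin 1 => if i.val + j.val + 1 = 1 then (1 : L) else 0)).Local v), BorelSpace (((UnitaryGroup.cmDatum L 2 (Matrix.of fun i j : Fin 2 => if i.val + j.val + 1 = 2 then (1 : L) else 0)).Local v × (UnitaryGroup.cmDatum L 1 (Matrix.of fun i j : Fin 1 => if i.val + j.val + 1 = 1 then (1 : L) else 0)).Local v) ⧸ Subgroup.centralizer ({a} : Set ((UnitaryGroup.cmDatum L 2 (Matrix.of fun i j : Fin 2 => if i.val + j.val + 1 = 2 then (1 : L) else 0)).Local v × (UnitaryGroup.cmDatum L 1 (Matrix.of fun i j : Fin 1 => if i.val + j.val + 1 = 1 then (1 : L) else 0)).Local v))) := fun _ => ⟨rfl⟩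
    letI : ∀ γ : Gqs L v, MeasurableSpace (Gqs L v ⧸ Subgroup.centralizer ({γ} : Set (Gqs L v))) := fun _ => borel _
    haveI : ∀ γ : Gqs L v, BorelSpace (Gqs L v ⧸ Subgroup.centralizer ({γ} : Set (Gqs L v))) := fun _ => ⟨rfl⟩
    ∀ (mHv : OrbitalMeasureFamily ((UnitaryGroup.cmDatum L 2 (Matrix.of fun i j : Fin 2 => if i.val + j.val + 1 = 2 then (1 : L) else 0)).Local v × (UnitaryGroup.cmDatum L 1 (Matrix.of fun i j : Fin 1 => if i.val + j.val + 1 = 1 then (1 : L) else 0)).Local v)) (mQv : OrbitalMeasureFamily (Gqs L v)),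
      mHv.IsCanonical (IsLocalGRegular L v) νHv →
      mQv.IsCanonical (fun γ => IsRegularElt (γ.val : GL (Fin 3) (UnitaryGroup.LocalRing L v))) νQv →
      IsLocalDeltaTransferExists L (qsForm L) v ((finExplicitCollection L (qsForm L) μ (finExplicitDelta_conj_left_all L (qsForm L) μ) (finExplicitDelta_conj_right_all L (qsForm L) μ)) v) mHv mQv IsLocSmooth IsLocSmooth →
      ∀ (π₁ πSt : IrrClass ((UnitaryGroup.cmDatum L 2 (Matrix.of fun i j : Fin 2 => if i.val + j.val + 1 = 2 then (1 : L) else 0)).Local v × (UnitaryGroup.cmDatum L 1 (Matrix.of fun i j : Fin 1 => if i.val + j.val + 1 = 1 then (1 : L) else 0)).Local v)),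
        HLengthTwoLabels L v
          (torusCharPair (conjLocal L (IsCMField.complexConj L) v) (cmLocalForm L 2 v) (cmLocalForm_eq_over L 2 v) 0
            ((torusLocalComponent L (IsCMField.complexConj L) v ξ.η).comp
                (quotConj (conjLocal L (IsCMField.complexConj L) v) (conjLocal_conjLocal_cm L v)) *
              halfModulusChar (UnitaryGroup.LocalRing L v))
            (torusLocalComponent L (IsCMField.complexConj L) v ξ.ψ))
          ((torusLocalComponent L (IsCMField.complexConj L) v ξ.ψ).comp (localDet (IsCMField.complexConj L) v (isUnit_antidiagOne_det L 1))) π₁ πSt →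
        (∀ fH : ((UnitaryGroup.cmDatum L 2 (Matrix.of fun i j : Fin 2 => if i.val + j.val + 1 = 2 then (1 : L) else 0)).Local v × (UnitaryGroup.cmDatum L 1 (Matrix.of fun i j : Fin 1 => if i.val + j.val + 1 = 1 then (1 : L) else 0)).Local v) → ℂ, IsLocSmooth fH → π₁.smoothTrace νHv fH = charDist (ξ.xiLocalChar v) νHv fH) →
      ∀ [MeasurableSpace (Gqs L v ⧸ Subgroup.center (Gqs L v))] [BorelSpace (Gqs L v ⧸ Subgroup.center (Gqs L v))]
        (μZ : Measure (Gqs L v ⧸ Subgroup.center (Gqs L v))) [μZ.IsHaarMeasure],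
      -- ══ the §12.5–12.6 DATUM on the model (★ TR carpet, a BINDER) and its COMPATIBILITY with the organ's currency (byte-identical with ★ p848567 ∕ ★ p848673) ══
      ∀ (𝔇 : Ch12Sec5.EllipticData (Gqs L v) ((UnitaryGroup.cmDatum L 2 (Matrix.of fun i j : Fin 2 => if i.val + j.val + 1 = 2 then (1 : L) else 0)).Local v × (UnitaryGroup.cmDatum L 1 (Matrix.of fun i j : Fin 1 => if i.val + j.val + 1 = 1 then (1 : L) else 0)).Local v)),
      𝔇.μG = νQv → 𝔇.μH = νHv → 𝔇.μGZ = μZ →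
      (∀ (φ : Gqs L v → ℂ) (fH : ((UnitaryGroup.cmDatum L 2 (Matrix.of fun i j : Fin 2 => if i.val + j.val + 1 = 2 then (1 : L) else 0)).Local v × (UnitaryGroup.cmDatum L 1 (Matrix.of fun i j : Fin 1 => if i.val + j.val + 1 = 1 then (1 : L) else 0)).Local v) → ℂ), 𝔇.IsTransfer φ fH ↔ IsLocalDeltaTransfer L (qsForm L) v ((finExplicitCollection L (qsForm L) μ (finExplicitDelta_conj_left_all L (qsForm L) μ) (finExplicitDelta_conj_right_all L (qsForm L) μ)) v) mHv mQv fH φ) →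
      ({πSt} : Finset (IrrClass ((UnitaryGroup.cmDatum L 2 (Matrix.of fun i j : Fin 2 => if i.val + j.val + 1 = 2 then (1 : L) else 0)).Local v × (UnitaryGroup.cmDatum L 1 (Matrix.of fun i j : Fin 1 => if i.val + j.val + 1 = 1 then (1 : L) else 0)).Local v))) ∈ 𝔇.sqPacketsH →
      -- ══ CARPET RELATIONS (named facts of ★ `Ch12Sec5` ∕ ★ `Ch12Sec6`, read at `𝔇`; union of ★ «Sa-COMPOSE» p848625 and ★ (R) p848976) ══
      𝔇.WeylIntegrationFormula → 𝔇.UpSpec → Ch12Sec6.PseudoCoeffExists 𝔇 → Ch12Sec6.PseudoCoeffTrace 𝔇 →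
      Ch12Sec6.Prop1261a 𝔇 → Ch12Sec6.Prop1261b 𝔇 → Ch12Sec6.Prop1261c 𝔇 →
      Ch12Sec6.LdsCharactersOpposite 𝔇 → Ch12Sec6.EllipticOfNotPrincipalSeries 𝔇 → Ch12Sec6.EllipticClassification 𝔇 →
      -- ══ PRINTED INPUTS NO CARPET STATES YET, in the socket shapes of LH6-p01's `Ch12Sec5Inputs` draft: (M1H) `PacketCharRegular`, (UPR) `UpRegular`, (ELL) `EllipticOfL2`,
      --    (DET) `DetNotL2`, (PIN) `PiNNotL2`, (LDS) `LdsNotL2`; and FIVE new sockets for the §12.7 (b)-row: (L2D∀) `D_G·χ_π ∈ L²(T)` for EVERY class, (U2) `D_G·χ_ρ^G ∈ L²(T)`,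
      --    (C1) `cartanG ⊆ cartanAll`, (C2) elliptic representatives a.e. in `G^e`, (C3) the other representatives a.e. in `G^r ∖ G^e` ══
      (∀ ρ ∈ 𝔇.sqPacketsH, Measurable (𝔇.packetCharH ρ) ∧ LocallyIntegrable (𝔇.packetCharH ρ) 𝔇.μH ∧
          Ch12Sec5.IsStableClassFunOn 𝔇.stConjH 𝔇.regH (𝔇.packetCharH ρ) ∧ Ch12Sec5.IsStableClassFunOn 𝔇.stConjH 𝔇.ellH (𝔇.packetCharH ρ) ∧
          ∀ fH : ((UnitaryGroup.cmDatum L 2 (Matrix.of fun i j : Fin 2 => if i.val + j.val + 1 = 2 then (1 : L) else 0)).Local v × (UnitaryGroup.cmDatum L 1 (Matrix.of fun i j : Fin 1 => if i.val + j.val + 1 = 1 then (1 : L) else 0)).Local v) → ℂ, IsLocSmooth fH → (∑ σ ∈ ρ, σ.smoothTrace 𝔇.μH fH) = ∫ h, fH h * 𝔇.packetCharH ρ h ∂𝔇.μH) →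
      (∀ ρ ∈ 𝔇.sqPacketsH, LocallyIntegrable (𝔇.up (𝔇.packetCharH ρ)) 𝔇.μG ∧
          ∀ x ∈ 𝔇.regG, ∀ᶠ y in 𝓝 x, 𝔇.up (𝔇.packetCharH ρ) y = 𝔇.up (𝔇.packetCharH ρ) x) →
      (∀ π : IrrClass (Gqs L v), 𝔇.IsL2 π → 𝔇.IsEllipticRep π) →
      (∀ ψ : ↥(Subgroup.center (Gqs L v)) →* ℂˣ, Continuous ψ → ¬ 𝔇.IsL2 (𝔇.detG ψ)) →
      (∀ ξ' : ((UnitaryGroup.cmDatum L 2 (Matrix.of fun i j : Fin 2 => if i.val + j.val + 1 = 2 then (1 : L) else 0)).Local v × (UnitaryGroup.cmDatum L 1 (Matrix.of fun i j : Fin 1 => if i.val + j.val + 1 = 1 then (1 : L) else 0)).Local v) →* ℂˣ, Continuous ξ' → ¬ 𝔇.IsL2 (𝔇.piN ξ')) →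
      (∀ P ∈ 𝔇.ldsPackets, ∀ σ ∈ P, ¬ 𝔇.IsL2 σ) →
      (∀ π : IrrClass (Gqs L v), ∀ T ∈ 𝔇.cartanG, MemLp (fun t : ↥T => (𝔇.DG (t : Gqs L v) : ℂ) * 𝔇.char π (t : Gqs L v)) 2 (𝔇.μT T)) →
      (∀ ρ ∈ 𝔇.sqPacketsH, ∀ T ∈ 𝔇.cartanG, MemLp (fun t : ↥T => (𝔇.DG (t : Gqs L v) : ℂ) * 𝔇.up (𝔇.packetCharH ρ) (t : Gqs L v)) 2 (𝔇.μT T)) →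
      𝔇.cartanG ⊆ 𝔇.cartanAll →
      (∀ T ∈ 𝔇.cartanG, ∀ᵐ t : ↥T ∂(𝔇.μT T), (t : Gqs L v) ∈ 𝔇.ellG) →
      (∀ T ∈ 𝔇.cartanAll, T ∉ 𝔇.cartanG → ∀ᵐ t : ↥T ∂(𝔇.μT T), (t : Gqs L v) ∈ 𝔇.regG ∧ (t : Gqs L v) ∉ 𝔇.ellG) →
      -- ══ further datum-level sockets of ★ (R) p848976: (LDSE) (LDSU) (LDS2) (R0) (MATE-UNIQ) (ST-L2) (PI2-L2) — (SC-L2) «supercuspidal ⇒ square-integrable» is DISCHARGED below (compact centre at the non-split `v`) ══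
      (∀ P ∈ 𝔇.ldsPackets, ∀ σ ∈ P, 𝔇.IsEllipticRep σ) →
      (∀ P ∈ 𝔇.ldsPackets, ∀ π' ∈ P, ∀ π : IrrClass (Gqs L v), π ∉ P → ¬ 𝔇.IsEllipticPair π π') →
      (∀ P ∈ 𝔇.ldsPackets, ∀ σ ∈ P, ∃ σ' ∈ P, σ' ≠ σ ∧ ∀ τ ∈ P, τ = σ ∨ τ = σ') →
      (∀ P ∈ 𝔇.ldsPackets, ∀ π' ∈ P, ∀ f : Gqs L v → ℂ, 𝔇.IsPseudoCoeff π' f → ∀ fH : ((UnitaryGroup.cmDatum L 2 (Matrix.of fun i j : Fin 2 => if i.val + j.val + 1 = 2 then (1 : L) else 0)).Local v × (UnitaryGroup.cmDatum L 1 (Matrix.of fun i j : Fin 1 => if i.val + j.val + 1 = 1 then (1 : L) else 0)).Local v) → ℂ, IsLocSmooth fH → 𝔇.IsTransfer f fH →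
          (∑ σ ∈ ({πSt} : Finset (IrrClass ((UnitaryGroup.cmDatum L 2 (Matrix.of fun i j : Fin 2 => if i.val + j.val + 1 = 2 then (1 : L) else 0)).Local v × (UnitaryGroup.cmDatum L 1 (Matrix.of fun i j : Fin 1 => if i.val + j.val + 1 = 1 then (1 : L) else 0)).Local v))), σ.smoothTrace 𝔇.μH fH) = 0) →
      (∀ σ u u' : IrrClass (Gqs L v), 𝔇.IsL2 σ → ¬ 𝔇.IsL2 u → ¬ 𝔇.IsL2 u' → 𝔇.IsEllipticPair u σ → 𝔇.IsEllipticPair u' σ → u = u') →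
      (∀ ψ' : ↥(Subgroup.center (Gqs L v)) →* ℂˣ, Continuous ψ' → 𝔇.IsL2 (𝔇.stG ψ')) →
      (∀ ξ' : ((UnitaryGroup.cmDatum L 2 (Matrix.of fun i j : Fin 2 => if i.val + j.val + 1 = 2 then (1 : L) else 0)).Local v × (UnitaryGroup.cmDatum L 1 (Matrix.of fun i j : Fin 1 => if i.val + j.val + 1 = 1 then (1 : L) else 0)).Local v) →* ℂˣ, Continuous ξ' → 𝔇.IsL2 (𝔇.pi2 ξ')) →
      -- ══ THE PRINCIPAL SERIES OF THE NON-SQUARE-INTEGRABLE CLASSES [§12.2]: a parameter map `par` into the tree's PAIR currency, with (PS1) (PS2) (PS3)=(JHL) (NONL2-PAR) (UNIQ-PAR) ══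
      ∀ (par : IrrClass (Gqs L v) → (((UnitaryGroup.LocalRing L v)ˣ →* ℂˣ) × (↥(normOneUnits (conjLocal L (IsCMField.complexConj L) v)) →* ℂˣ))),
      (∀ π ∈ 𝔇.irredPS, ¬ 𝔇.IsL2 π → ∀ f : Gqs L v → ℂ, IsLocSmooth f → π.smoothTrace νQv f = Representation.smoothTrace (G := Gqs L v) (UnitaryGroup.cmPrincipalSeries L 3 v (UnitaryGroup.cmTorusCharPair L v (par π).1 (par π).2)) νQv f) →
      (∀ π σ : IrrClass (Gqs L v), ¬ 𝔇.IsL2 π → 𝔇.IsL2 σ → 𝔇.IsEllipticPair π σ → ∀ f : Gqs L v → ℂ, IsLocSmooth f →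
          π.smoothTrace νQv f + σ.smoothTrace νQv f = Representation.smoothTrace (G := Gqs L v) (UnitaryGroup.cmPrincipalSeries L 3 v (UnitaryGroup.cmTorusCharPair L v (par π).1 (par π).2)) νQv f) →
      (∀ P ∈ 𝔇.ldsPackets, ∀ π' ∈ P, ∀ π'' ∈ P, π' ≠ π'' → par π'' = par π' ∧ ∀ f : Gqs L v → ℂ, IsLocSmooth f →
          π'.smoothTrace νQv f + π''.smoothTrace νQv f = Representation.smoothTrace (G := Gqs L v) (UnitaryGroup.cmPrincipalSeries L 3 v (UnitaryGroup.cmTorusCharPair L v (par π').1 (par π').2)) νQv f) →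
      (∀ π : IrrClass (Gqs L v), ¬ 𝔇.IsL2 π →
          π.IsConstituentOf (UnitaryGroup.cmPrincipalSeries L 3 v (UnitaryGroup.cmTorusCharPair L v (par π).1 (par π).2)) ∧
            Continuous (par π).1 ∧ Continuous (par π).2) →
      (∀ u u' : IrrClass (Gqs L v), ¬ 𝔇.IsL2 u → ¬ 𝔇.IsL2 u' →
          (par u' = par u ∨ par u' = (conjInvChar (conjLocal L (IsCMField.complexConj L) v) (par u).1, (par u).2)) →
          u' = u ∨ ∃ P ∈ 𝔇.ldsPackets, u ∈ P ∧ u' ∈ P) →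
      -- ══ (F) «Sa-TORUS★» BY NAME AS A BINDER until LH6-p05's organ-level ★ with (SHF≠0) lands: the SECOND DISJUNCT of ★ (R) `sa_regroup_of_carpet` (interface v2final 5d9fdf194fdb0980, the clauses ★ p849030 consumes) is impossible ══
      (∀ (b : IrrClass (Gqs L v) → ℤ) (d : (((UnitaryGroup.LocalRing L v)ˣ →* ℂˣ) × (↥(normOneUnits (conjLocal L (IsCMField.complexConj L) v)) →* ℂˣ)) → ℤ),
        (∀ π : IrrClass (Gqs L v), b π ≠ 0 → π.IsSquareIntegrable μZ) →
        (∀ χ χ' : (((UnitaryGroup.LocalRing L v)ˣ →* ℂˣ) × (↥(normOneUnits (conjLocal L (IsCMField.complexConj L) v)) →* ℂˣ)), d χ ≠ 0 → d χ' ≠ 0 → χ'.2 = χ.2 →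
          χ'.1 = conjInvChar (conjLocal L (IsCMField.complexConj L) v) χ.1 → χ' = χ) →
        (∀ χ : (((UnitaryGroup.LocalRing L v)ˣ →* ℂˣ) × (↥(normOneUnits (conjLocal L (IsCMField.complexConj L) v)) →* ℂˣ)), d χ ≠ 0 → Continuous χ.1 ∧ Continuous χ.2) →
        (∀ (fH : ((UnitaryGroup.cmDatum L 2 (Matrix.of fun i j : Fin 2 => if i.val + j.val + 1 = 2 then (1 : L) else 0)).Local v × (UnitaryGroup.cmDatum L 1 (Matrix.of fun i j : Fin 1 => if i.val + j.val + 1 = 1 then (1 : L) else 0)).Local v) → ℂ) (φ : Gqs L v → ℂ), IsLocSmooth fH → IsLocSmooth φ →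
          IsLocalDeltaTransfer L (qsForm L) v ((finExplicitCollection L (qsForm L) μ (finExplicitDelta_conj_left_all L (qsForm L) μ) (finExplicitDelta_conj_right_all L (qsForm L) μ)) v) mHv mQv fH φ →
          Summable (fun π : IrrClass (Gqs L v) => (b π : ℂ) * π.smoothTrace νQv φ) ∧
          Summable (fun χ : (((UnitaryGroup.LocalRing L v)ˣ →* ℂˣ) × (↥(normOneUnits (conjLocal L (IsCMField.complexConj L) v)) →* ℂˣ)) => (d χ : ℂ) * Representation.smoothTrace (G := Gqs L v) (UnitaryGroup.cmPrincipalSeries L 3 v (UnitaryGroup.cmTorusCharPair L v χ.1 χ.2)) νQv φ) ∧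
          ∑' π : IrrClass (Gqs L v), (b π : ℂ) * π.smoothTrace νQv φ + ∑' χ : (((UnitaryGroup.LocalRing L v)ˣ →* ℂˣ) × (↥(normOneUnits (conjLocal L (IsCMField.complexConj L) v)) →* ℂˣ)), (d χ : ℂ) * Representation.smoothTrace (G := Gqs L v) (UnitaryGroup.cmPrincipalSeries L 3 v (UnitaryGroup.cmTorusCharPair L v χ.1 χ.2)) νQv φ = πSt.smoothTrace νHv fH) →
        (∃ χ₀ : (((UnitaryGroup.LocalRing L v)ˣ →* ℂˣ) × (↥(normOneUnits (conjLocal L (IsCMField.complexConj L) v)) →* ℂˣ)), d χ₀ ≠ 0) → False) →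
      ∀ aX : IrrClass (Gqs L v) → ℤ, (Function.support aX).Countable →
        (∀ π : IrrClass (Gqs L v), aX π ≠ 0 → π.IsUnitarizable) →
        (∀ (fH : ((UnitaryGroup.cmDatum L 2 (Matrix.of fun i j : Fin 2 => if i.val + j.val + 1 = 2 then (1 : L) else 0)).Local v × (UnitaryGroup.cmDatum L 1 (Matrix.of fun i j : Fin 1 => if i.val + j.val + 1 = 1 then (1 : L) else 0)).Local v) → ℂ) (φ : Gqs L v → ℂ), IsLocSmooth fH → IsLocSmooth φ →
            IsLocalDeltaTransfer L (qsForm L) v ((finExplicitCollection L (qsForm L) μ (finExplicitDelta_conj_left_all L (qsForm L) μ) (finExplicitDelta_conj_right_all L (qsForm L) μ)) v) mHv mQv fH φ →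
            Summable (fun π : IrrClass (Gqs L v) => (aX π : ℂ) * π.smoothTrace νQv φ) ∧
              ∑' π : IrrClass (Gqs L v), (aX π : ℂ) * π.smoothTrace νQv φ = πSt.smoothTrace νHv fH) →
        (Function.support aX).Finite ∧ ∀ π : IrrClass (Gqs L v), aX π ≠ 0 → π.IsSquareIntegrable μZ := by
  intro L _ _ _ μ ξ v hns hμu hμω _ _ _ _ νHv νQv _ _ _ _ mHv mQv hcanH hcanQ hTv π₁ πSt hHL hπ₁ _ _ μZ _
    𝔇 hμG hμH hμGZ hTr hρ hW hUp hPCE hPCT h61a h61b h61c hLO hEONPS hEC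
    hHCH hUpReg hEll hDet hPiN hLds hL2domAll hUdom hsub hTell hTnon
    hLdsE hLdsU hLds2 hR0 hMU hStL2 hPi2L2
    par hPS1 hPS2 hPS3 hNP hUP
    hF aX hcnt hunit hid
  -- the organ's quotient σ-algebras, re-installed as local instances (the datum's instance slots are these)
  letI : ∀ a' : ((UnitaryGroup.cmDatum L 2 (Matrix.of fun i j : Fin 2 => if i.val + j.val + 1 = 2 then (1 : L) else 0)).Local v × (UnitaryGroup.cmDatum L 1 (Matrix.of fun i j : Fin 1 => if i.val + j.val + 1 = 1 then (1 : L) else 0)).Local v), MeasurableSpace (((UnitaryGroup.cmDatum L 2 (Matrix.of fun i j : Fin 2 => if i.val + j.val + 1 = 2 then (1 : L) else 0)).Local v × (UnitaryGroup.cmDatum L 1 (Matrix.of fun i j : Fin 1 => if i.val + j.val + 1 = 1 then (1 : L) else 0)).Local v) ⧸ Subgroup.centralizer ({a'} : Set ((UnitaryGroup.cmDatum L 2 (Matrix.of fun i j : Fin 2 => if i.val + j.val + 1 = 2 then (1 : L) else 0)).Local v × (UnitaryGroup.cmDatum L 1 (Matrix.of fun i j : Fin 1 => if i.val + j.val + 1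 = 1 then (1 : L) else 0)).Local v))) := fun _ => borel _
  haveI : ∀ a' : ((UnitaryGroup.cmDatum L 2 (Matrix.of fun i j : Fin 2 => if i.val + j.val + 1 = 2 then (1 : L) else 0)).Local v × (UnitaryGroup.cmDatum L 1 (Matrix.of fun i j : Fin 1 => if i.val + j.val + 1 = 1 then (1 : L) else 0)).Local v), BorelSpace (((UnitaryGroup.cmDatum L 2 (Matrix.of fun i j : Fin 2 => if i.val + j.val + 1 = 2 then (1 : L) else 0)).Local v × (UnitaryGroup.cmDatum L 1 (Matrix.of fun i j : Fin 1 => if i.val + j.val + 1 = 1 then (1 : L) else 0)).Local v) ⧸ Subgroup.centralizer ({a'} : Set ((UnitaryGroup.cmDatum L 2 (Matrix.of fun i j : Fin 2 => if i.val + j.val + 1 = 2 then (1 : L) else 0)).Local v × (UnitaryGroup.cmDatum L 1 (Matrix.of fun i j : Fin 1 => if i.val + j.val + 1 = 1 then (1 : L) else 0)).Local v))) := fun _ => ⟨rfl⟩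
  letI : ∀ γ : Gqs L v, MeasurableSpace (Gqs L v ⧸ Subgroup.centralizer ({γ} : Set (Gqs L v))) := fun _ => borel _
  haveI : ∀ γ : Gqs L v, BorelSpace (Gqs L v ⧸ Subgroup.centralizer ({γ} : Set (Gqs L v))) := fun _ => ⟨rfl⟩
  classical
  -- ══ (SC-L2) DISCHARGED: the centre of `U(Φ₃)(L⁺_v)` is compact at the non-split `v`, so supercuspidal ⇒ square-integrable modulo the centre ══
  have hZ : IsCompact ((Subgroup.center (Gqs L v) : Subgroup (Gqs L v)) : Set (Gqs L v)) :=
    (F0P3bLocalNonsplitCompactCenter.local_nonsplit_compactOpen_center_of_center_le L 3 (qsForm L) (isUnit_antidiagOne_det L 3) v hns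
      (forall_mem_center_cmLocal_eq_scalar L (qsForm L) (antidiagOne_isHermitian L 3) (isUnit_antidiagOne_det L 3) v hns)).2
  have hScL2 : ∀ π : IrrClass (Gqs L v), π.IsSupercuspidal → 𝔇.IsL2 π := fun π hπ => by
    show IrrClass.IsSquareIntegrable 𝔇.μGZ π
    rw [hμGZ]
    exact IrrClass.isSquareIntegrable_of_isSupercuspidal_of_isCompact_center μZ hZ π hπ
  -- ══ packet data for `ρ = {πSt}` [(M1H), (UPR), (U2)] ══
  obtain ⟨hρm, hρli, hρst, -, hρtr⟩ := hHCH _ hρ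
  obtain ⟨hUli, -⟩ := hUpReg _ hρ
  have hx := hUdom _ hρ
  -- ══ (PAIRS-ONE-L2) from (DET)(PIN)(LDS) ══
  have hpairL2 : ∀ π π' : IrrClass (Gqs L v), 𝔇.IsEllipticPair π π' → 𝔇.IsL2 π → ¬ 𝔇.IsL2 π' :=
    fun π π' hp hπ => F0P3cStCharTSFinOfL2.not_isL2_of_isEllipticPair 𝔇 hDet hPiN hLds π π' hp hπ
  -- ══ «UP-PSEUDO» DISCHARGED at `x := 𝔇.up (𝔇.packetCharH {πSt})` (★ K1b), in (R)'s shape ══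
  have hup : ∀ (σ : IrrClass (Gqs L v)) (f : Gqs L v → ℂ) (fH : ((UnitaryGroup.cmDatum L 2 (Matrix.of fun i j : Fin 2 => if i.val + j.val + 1 = 2 then (1 : L) else 0)).Local v × (UnitaryGroup.cmDatum L 1 (Matrix.of fun i j : Fin 1 => if i.val + j.val + 1 = 1 then (1 : L) else 0)).Local v) → ℂ), 𝔇.IsPseudoCoeff σ f → IsLocSmooth fH → 𝔇.IsTransfer f fH →
      πSt.smoothTrace νHv fH = 𝔇.innerG (𝔇.up (𝔇.packetCharH {πSt})) (𝔇.char σ) := by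
    intro σ f fH hf hfH htr
    have h := F0P3cStCharTSUpPseudo.packetTrace_transfer_eq_innerG_up 𝔇 hW hUp hsub hTell hTnon {πSt} hρm hρli hρst hρtr hUli hx (hL2domAll σ) hf hfH htr
    rw [Finset.sum_singleton, hμH] at h
    exact h
  -- ══ «FIN» DISCHARGED (★ `finite_isL2_innerG_ne_zero`), in the matching ∕ functional currency of ★ «Sa-COMPOSE» ══
  set M : (((UnitaryGroup.cmDatum L 2 (Matrix.of fun i j : Fin 2 => if i.val + j.val + 1 = 2 then (1 : L) else 0)).Local v × (UnitaryGroup.cmDatum L 1 (Matrix.of fun i j : Fin 1 => if i.val + j.val + 1 = 1 then (1 : L) else 0)).Local v) → ℂ) → (Gqs L v → ℂ) → Prop := fun fH φ => IsLocalDeltaTransfer L (qsForm L) v ((finExplicitCollection L (qsForm L) μ (finExplicitDelta_conj_left_all L (qsForm L) μ) (finExplicitDelta_conj_right_all L (qsForm L) μ)) v) mHv mQv fH φ with hM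
  set R : (((UnitaryGroup.cmDatum L 2 (Matrix.of fun i j : Fin 2 => if i.val + j.val + 1 = 2 then (1 : L) else 0)).Local v × (UnitaryGroup.cmDatum L 1 (Matrix.of fun i j : Fin 1 => if i.val + j.val + 1 = 1 then (1 : L) else 0)).Local v) → ℂ) → ℂ := fun fH => ∑ σ ∈ ({πSt} : Finset (IrrClass ((UnitaryGroup.cmDatum L 2 (Matrix.of fun i j : Fin 2 => if i.val + j.val + 1 = 2 then (1 : L) else 0)).Local v × (UnitaryGroup.cmDatum L 1 (Matrix.of fun i j : Fin 1 => if i.val + j.val + 1 = 1 then (1 : L) else 0)).Local v))), σ.smoothTrace 𝔇.μH fH with hR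
  have hTv' : ∀ φ : Gqs L v → ℂ, φ ∈ SchwartzBruhat (Gqs L v) → ∃ fH : ((UnitaryGroup.cmDatum L 2 (Matrix.of fun i j : Fin 2 => if i.val + j.val + 1 = 2 then (1 : L) else 0)).Local v × (UnitaryGroup.cmDatum L 1 (Matrix.of fun i j : Fin 1 => if i.val + j.val + 1 = 1 then (1 : L) else 0)).Local v) → ℂ, IsLocSmooth fH ∧ M fH φ := fun φ hφ => hTv φ ⟨hφ.1, hφ.2⟩
  have hMT : ∀ (fH : ((UnitaryGroup.cmDatum L 2 (Matrix.of fun i j : Fin 2 => if i.val + j.val + 1 = 2 then (1 : L) else 0)).Local v × (UnitaryGroup.cmDatum L 1 (Matrix.of fun i j : Fin 1 => if i.val + j.val + 1 = 1 then (1 : L) else 0)).Local v) → ℂ) (φ : Gqs L v → ℂ), M fH φ → 𝔇.IsTransfer φ fH := fun fH φ h => (hTr φ fH).2 h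
  have hid' : ∀ (fH : ((UnitaryGroup.cmDatum L 2 (Matrix.of fun i j : Fin 2 => if i.val + j.val + 1 = 2 then (1 : L) else 0)).Local v × (UnitaryGroup.cmDatum L 1 (Matrix.of fun i j : Fin 1 => if i.val + j.val + 1 = 1 then (1 : L) else 0)).Local v) → ℂ) (φ : Gqs L v → ℂ), IsLocSmooth fH → φ ∈ SchwartzBruhat (Gqs L v) → M fH φ →
      Summable (fun π : IrrClass (Gqs L v) => (aX π : ℂ) * π.smoothTrace 𝔇.μG φ) ∧
        ∑' π : IrrClass (Gqs L v), (aX π : ℂ) * π.smoothTrace 𝔇.μG φ = R fH := by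
    intro fH φ hfH hφ hm
    obtain ⟨hs, ht⟩ := hid fH φ hfH ⟨hφ.1, hφ.2⟩ hm
    rw [hμG]
    refine ⟨hs, ?_⟩
    rw [ht]
    show πSt.smoothTrace νHv fH = ∑ σ ∈ ({πSt} : Finset (IrrClass ((UnitaryGroup.cmDatum L 2 (Matrix.of fun i j : Fin 2 => if i.val + j.val + 1 = 2 then (1 : L) else 0)).Local v × (UnitaryGroup.cmDatum L 1 (Matrix.of fun i j : Fin 1 => if i.val + j.val + 1 = 1 then (1 : L) else 0)).Local v))), σ.smoothTrace 𝔇.μH fH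
    rw [Finset.sum_singleton, hμH]
  have hupR : ∀ (π : IrrClass (Gqs L v)) (f : Gqs L v → ℂ) (fH : ((UnitaryGroup.cmDatum L 2 (Matrix.of fun i j : Fin 2 => if i.val + j.val + 1 = 2 then (1 : L) else 0)).Local v × (UnitaryGroup.cmDatum L 1 (Matrix.of fun i j : Fin 1 => if i.val + j.val + 1 = 1 then (1 : L) else 0)).Local v) → ℂ),
      𝔇.IsPseudoCoeff π f → 𝔇.IsTransfer f fH → IsLocSmooth fH → R fH = 𝔇.innerG (𝔇.up (𝔇.packetCharH {πSt})) (𝔇.char π) :=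
    fun π f fH hf htr hfH =>
      F0P3cStCharTSUpPseudo.packetTrace_transfer_eq_innerG_up 𝔇 hW hUp hsub hTell hTnon {πSt} hρm hρli hρst hρtr hUli hx (hL2domAll π) hf hfH htr
  have hFin : {σ : IrrClass (Gqs L v) | 𝔇.IsL2 σ ∧ 𝔇.innerG (𝔇.up (𝔇.packetCharH {πSt})) (𝔇.char σ) ≠ 0}.Finite :=
    F0P3cStCharTSScFin.finite_isL2_innerG_ne_zero 𝔇 hTell hEll hpairL2 (fun π _ => hL2domAll π) hPCE hPCT h61a h61b h61c IsLocSmooth M R hTv' hMT aX hid' _ hx hupR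
  -- ══ (R) «Sa-REGROUP★»: print's (12.7.1) at the organ's binders ══
  have hmain := F0P3cStCharTSSaRegroup.sa_regroup_of_carpet L μ ξ v hns hμu hμω νHv νQv mHv mQv hcanH hcanQ hTv π₁ πSt hHL hπ₁ μZ
    𝔇 hμG hμH hμGZ hTr hρ hPCE hPCT h61a h61b h61c hLO hEONPS hEC hTell hEll hDet hPiN hLds hLdsE hLdsU hLds2 hR0 hMU hScL2 hStL2 hPi2L2
    (𝔇.up (𝔇.packetCharH {πSt})) hup hFin par hPS1 hPS2 hPS3 hNP hUP aX hcnt hunit hid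
  -- ══ (S-a).2 «every member square-integrable»: the second disjunct is impossible by (F) ══
  have hL2 : ∀ π : IrrClass (Gqs L v), aX π ≠ 0 → π.IsSquareIntegrable μZ := by
    rcases hmain with hall | ⟨b, d, -, -, hbL2, hex, hWred, -, hcont, hidn⟩
    · exact hall
    · exact (hF b d hbL2 hWred hcont hidn hex).elim
  -- ══ (S-a).1 «finite» by ★ «Sa-COMPOSE» ══
  exact ⟨F0P3cStCharTSSaCompose.stSupportFinite_of_members_isL2_at_organ L μ ξ v hns hμu hμω νHv νQv mHv mQv hcanH hcanQ hTv π₁ πSt hHL hπ₁ μZ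
    𝔇 hμG hμH hμGZ hTr hρ hW hUp hPCE hPCT h61a h61b h61c hHCH hUpReg hEll hDet hPiN hLds hL2domAll hUdom hsub hTell hTnon aX hcnt hunit hid hL2, hL2⟩


/-! ## §2 (ED. 2, LH6-p05) «Sa-HEAD★» with `hF` DISCHARGED by ★ F3′ (p849140): the split-torus sockets (PSE)(TOR)(WM∕L2M)(HM)(PSM)(SHF≠0) replace `hF` -/

open scoped Pointwise in
set_option maxHeartbeats 1600000 in
/-- **The (S-a) HEAD `stSupportFiniteSqInt_of_carpet` — organ `stub_StSupportFiniteSqInt` at its literal binders; (F) is no longer a binder.**  Binders = §1's with `hF`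
REPLACED by ★ F3′ p849140's split-torus block, its `b σ ≠ 0` ∕ `d χ ≠ 0`-restricted clauses asked for EVERY `μZ`-square-integrable class ∕ EVERY CONTINUOUS pair: (PSE)
[§12.6 p. 187], (TOR) `M = E_vˣ × E¹_v` (left-invariant measure, compact part `M_c`, ray generator `a`, W-flip `ω`), posited `F_f`, `Ω`, `toC`, (WM∕L2M) [§12.5 p. 182],
(HM) [p. 193], (PSM) [p. 193; van Dijk], (SHF) on the shells `n ≠ 0` [L. 12.7.1 proof p. 191].  Proof: one `exact` — §1 with `hF :=` ★ F3′ fed through (CONT) and `hbL2`.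
[cite: Rogawski1990, §12.7 Lemma 12.7.2 (proof) pp. 191–194; Lemma 12.7.1 (proof) p. 191; §12.5 p. 182; §12.6 p. 187] -/
theorem stSupportFiniteSqInt_of_carpet :
  ∀ (L : Type) [Field L] [NumberField L] [IsCMField L] (μ : HeckeCharacter L) (ξ : OneDimAutRepH L) (v : HeightOneSpectrum (𝓞 ↥(maximalRealSubfield L))),
    (∀ w : PlacesOver L v, IsCMField.complexConj L • w.1 = w.1) → μ.IsUnitary →
    (∀ x : Literature.NumberTheory.GaloisRepresentations.ideleGroup ↥(maximalRealSubfield L),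
      μ (AdeleRing.ideleBaseChange (↥(maximalRealSubfield L)) L x) = quadraticHeckeCharCM L x) →
    ∀ [MeasurableSpace ((UnitaryGroup.cmDatum L 2 (Matrix.of fun i j : Fin 2 => if i.val + j.val + 1 = 2 then (1 : L) else 0)).Local v × (UnitaryGroup.cmDatum L 1 (Matrix.of fun i j : Fin 1 => if i.val + j.val + 1 = 1 then (1 : L) else 0)).Local v)] [BorelSpace ((UnitaryGroup.cmDatum L 2 (Matrix.of fun i j : Fin 2 => if i.val + j.val + 1 = 2 then (1 : L) else 0)).Local v × (UnitaryGroup.cmDatum L 1 (Matrix.of fun i j : Fin 1 => if i.val + j.val + 1 = 1 then (1 : L) else 0)).Local v)] [MeasurableSpace (Gqs L v)] [BorelSpace (Gqs L v)]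
      (νHv : Measure ((UnitaryGroup.cmDatum L 2 (Matrix.of fun i j : Fin 2 => if i.val + j.val + 1 = 2 then (1 : L) else 0)).Local v × (UnitaryGroup.cmDatum L 1 (Matrix.of fun i j : Fin 1 => if i.val + j.val + 1 = 1 then (1 : L) else 0)).Local v)) (νQv : Measure (Gqs L v))
      [νHv.IsHaarMeasure] [νHv.IsMulRightInvariant] [νQv.IsHaarMeasure] [νQv.IsMulRightInvariant],
    letI : ∀ a : ((UnitaryGroup.cmDatum L 2 (Matrix.of fun i j : Fin 2 => if i.val + j.val + 1 = 2 then (1 : L) else 0)).Local v × (UnitaryGroup.cmDatum L 1 (Matrix.of fun i j : Fin 1 => if i.val + j.val + 1 = 1 then (1 : L) else 0)).Local v), MeasurableSpace (((UnitaryGroup.cmDatum L 2 (Matrix.of fun i j : Fin 2 => if i.val + j.val + 1 = 2 then (1 : L) else 0)).Local v × (UnitaryGroup.cmDatum L 1 (Matrix.of fun i j : Fin 1 => if i.val + j.val + 1 = 1 then (1 : L) else 0)).Local v) ⧸ Subgroup.centralizer ({a} : Set ((UnitaryGroup.cmDatum L 2 (Matrix.of fun i j : Fin 2 => if i.val + j.val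 + 1 = 2 then (1 : L) else 0)).Local v × (UnitaryGroup.cmDatum L 1 (Matrix.of fun i j : Fin 1 => if i.val + j.val + 1 = 1 then (1 : L) else 0)).Local v))) := fun _ => borel _
    haveI : ∀ a : ((UnitaryGroup.cmDatum L 2 (Matrix.of fun i j : Fin 2 => if i.val + j.val + 1 = 2 then (1 : L) else 0)).Local v × (UnitaryGroup.cmDatum L 1 (Matrix.of fun i j : Fin 1 => if i.val + j.val + 1 = 1 then (1 : L) else 0)).Local v), BorelSpace (((UnitaryGroup.cmDatum L 2 (Matrix.of fun i j : Fin 2 => if i.val + j.val + 1 = 2 then (1 : L) else 0)).Local v × (UnitaryGroup.cmDatum L 1 (Matrix.of fun i j : Fin 1 => if i.val + j.val + 1 = 1 then (1 : L) else 0)).Local v) ⧸ Subgroup.centralizer ({a} : Set ((UnitaryGroup.cmDatum L 2 (Matrix.of fun i j : Fin 2 => if i.val + j.val + 1 = 2 then (1 : L) else 0)).Local v × (UnitaryGroup.cmDatum L 1 (Matrix.of fun i j : Fin 1 => if i.val + j.val + 1 = 1 then (1 : L) else 0)).Local v))) := fun _ => ⟨rfl⟩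
    letI : ∀ γ : Gqs L v, MeasurableSpace (Gqs L v ⧸ Subgroup.centralizer ({γ} : Set (Gqs L v))) := fun _ => borel _
    haveI : ∀ γ : Gqs L v, BorelSpace (Gqs L v ⧸ Subgroup.centralizer ({γ} : Set (Gqs L v))) := fun _ => ⟨rfl⟩
    ∀ (mHv : OrbitalMeasureFamily ((UnitaryGroup.cmDatum L 2 (Matrix.of fun i j : Fin 2 => if i.val + j.val + 1 = 2 then (1 : L) else 0)).Local v × (UnitaryGroup.cmDatum L 1 (Matrix.of fun i j : Fin 1 => if i.val + j.val + 1 = 1 then (1 : L) else 0)).Local v)) (mQv : OrbitalMeasureFamily (Gqs L v)),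
      mHv.IsCanonical (IsLocalGRegular L v) νHv →
      mQv.IsCanonical (fun γ => IsRegularElt (γ.val : GL (Fin 3) (UnitaryGroup.LocalRing L v))) νQv →
      IsLocalDeltaTransferExists L (qsForm L) v ((finExplicitCollection L (qsForm L) μ (finExplicitDelta_conj_left_all L (qsForm L) μ) (finExplicitDelta_conj_right_all L (qsForm L) μ)) v) mHv mQv IsLocSmooth IsLocSmooth →
      ∀ (π₁ πSt : IrrClass ((UnitaryGroup.cmDatum L 2 (Matrix.of fun i j : Fin 2 => if i.val + j.val + 1 = 2 then (1 : L) else 0)).Local v × (UnitaryGroup.cmDatum L 1 (Matrix.of fun i j : Fin 1 => if i.val + j.val + 1 = 1 then (1 : L) else 0)).Local v)),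
        HLengthTwoLabels L v
          (torusCharPair (conjLocal L (IsCMField.complexConj L) v) (cmLocalForm L 2 v) (cmLocalForm_eq_over L 2 v) 0
            ((torusLocalComponent L (IsCMField.complexConj L) v ξ.η).comp
                (quotConj (conjLocal L (IsCMField.complexConj L) v) (conjLocal_conjLocal_cm L v)) *
              halfModulusChar (UnitaryGroup.LocalRing L v))
            (torusLocalComponent L (IsCMField.complexConj L) v ξ.ψ))
          ((torusLocalComponent L (IsCMField.complexConj L) v ξ.ψ).comp (localDet (IsCMField.complexConj L) v (isUnit_antidiagOne_det L 1))) π₁ πSt →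
        (∀ fH : ((UnitaryGroup.cmDatum L 2 (Matrix.of fun i j : Fin 2 => if i.val + j.val + 1 = 2 then (1 : L) else 0)).Local v × (UnitaryGroup.cmDatum L 1 (Matrix.of fun i j : Fin 1 => if i.val + j.val + 1 = 1 then (1 : L) else 0)).Local v) → ℂ, IsLocSmooth fH → π₁.smoothTrace νHv fH = charDist (ξ.xiLocalChar v) νHv fH) →
      ∀ [MeasurableSpace (Gqs L v ⧸ Subgroup.center (Gqs L v))] [BorelSpace (Gqs L v ⧸ Subgroup.center (Gqs L v))]
        (μZ : Measure (Gqs L v ⧸ Subgroup.center (Gqs L v))) [μZ.IsHaarMeasure],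
      -- ══ the §12.5–12.6 DATUM on the model (★ TR carpet, a BINDER) and its COMPATIBILITY with the organ's currency (byte-identical with ★ p848567 ∕ ★ p848673) ══
      ∀ (𝔇 : Ch12Sec5.EllipticData (Gqs L v) ((UnitaryGroup.cmDatum L 2 (Matrix.of fun i j : Fin 2 => if i.val + j.val + 1 = 2 then (1 : L) else 0)).Local v × (UnitaryGroup.cmDatum L 1 (Matrix.of fun i j : Fin 1 => if i.val + j.val + 1 = 1 then (1 : L) else 0)).Local v)),
      𝔇.μG = νQv → 𝔇.μH = νHv → 𝔇.μGZ = μZ →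
      (∀ (φ : Gqs L v → ℂ) (fH : ((UnitaryGroup.cmDatum L 2 (Matrix.of fun i j : Fin 2 => if i.val + j.val + 1 = 2 then (1 : L) else 0)).Local v × (UnitaryGroup.cmDatum L 1 (Matrix.of fun i j : Fin 1 => if i.val + j.val + 1 = 1 then (1 : L) else 0)).Local v) → ℂ), 𝔇.IsTransfer φ fH ↔ IsLocalDeltaTransfer L (qsForm L) v ((finExplicitCollection L (qsForm L) μ (finExplicitDelta_conj_left_all L (qsForm L) μ) (finExplicitDelta_conj_right_all L (qsForm L) μ)) v) mHv mQv fH φ) →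
      ({πSt} : Finset (IrrClass ((UnitaryGroup.cmDatum L 2 (Matrix.of fun i j : Fin 2 => if i.val + j.val + 1 = 2 then (1 : L) else 0)).Local v × (UnitaryGroup.cmDatum L 1 (Matrix.of fun i j : Fin 1 => if i.val + j.val + 1 = 1 then (1 : L) else 0)).Local v))) ∈ 𝔇.sqPacketsH →
      -- ══ CARPET RELATIONS (named facts of ★ `Ch12Sec5` ∕ ★ `Ch12Sec6`, read at `𝔇`; union of ★ «Sa-COMPOSE» p848625 and ★ (R) p848976) ══
      𝔇.WeylIntegrationFormula → 𝔇.UpSpec → Ch12Sec6.PseudoCoeffExists 𝔇 → Ch12Sec6.PseudoCoeffTrace 𝔇 →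
      Ch12Sec6.Prop1261a 𝔇 → Ch12Sec6.Prop1261b 𝔇 → Ch12Sec6.Prop1261c 𝔇 →
      Ch12Sec6.LdsCharactersOpposite 𝔇 → Ch12Sec6.EllipticOfNotPrincipalSeries 𝔇 → Ch12Sec6.EllipticClassification 𝔇 →
      -- ══ PRINTED INPUTS NO CARPET STATES YET, in the socket shapes of LH6-p01's `Ch12Sec5Inputs` draft: (M1H) `PacketCharRegular`, (UPR) `UpRegular`, (ELL) `EllipticOfL2`,
      --    (DET) `DetNotL2`, (PIN) `PiNNotL2`, (LDS) `LdsNotL2`; and FIVE new sockets for the §12.7 (b)-row: (L2D∀) `D_G·χ_π ∈ L²(T)` for EVERY class, (U2) `D_G·χ_ρ^G ∈ L²(T)`,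
      --    (C1) `cartanG ⊆ cartanAll`, (C2) elliptic representatives a.e. in `G^e`, (C3) the other representatives a.e. in `G^r ∖ G^e` ══
      (∀ ρ ∈ 𝔇.sqPacketsH, Measurable (𝔇.packetCharH ρ) ∧ LocallyIntegrable (𝔇.packetCharH ρ) 𝔇.μH ∧
          Ch12Sec5.IsStableClassFunOn 𝔇.stConjH 𝔇.regH (𝔇.packetCharH ρ) ∧ Ch12Sec5.IsStableClassFunOn 𝔇.stConjH 𝔇.ellH (𝔇.packetCharH ρ) ∧
          ∀ fH : ((UnitaryGroup.cmDatum L 2 (Matrix.of fun i j : Fin 2 => if i.val + j.val + 1 = 2 then (1 : L) else 0)).Local v × (UnitaryGroup.cmDatum L 1 (Matrix.of fun i j : Fin 1 => if i.val + j.val + 1 = 1 then (1 : L) else 0)).Local v) → ℂ, IsLocSmooth fH → (∑ σ ∈ ρ, σ.smoothTrace 𝔇.μH fH) = ∫ h, fH h * 𝔇.packetCharH ρ h ∂𝔇.μH) →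
      (∀ ρ ∈ 𝔇.sqPacketsH, LocallyIntegrable (𝔇.up (𝔇.packetCharH ρ)) 𝔇.μG ∧
          ∀ x ∈ 𝔇.regG, ∀ᶠ y in 𝓝 x, 𝔇.up (𝔇.packetCharH ρ) y = 𝔇.up (𝔇.packetCharH ρ) x) →
      (∀ π : IrrClass (Gqs L v), 𝔇.IsL2 π → 𝔇.IsEllipticRep π) →
      (∀ ψ : ↥(Subgroup.center (Gqs L v)) →* ℂˣ, Continuous ψ → ¬ 𝔇.IsL2 (𝔇.detG ψ)) →
      (∀ ξ' : ((UnitaryGroup.cmDatum L 2 (Matrix.of fun i j : Fin 2 => if i.val + j.val + 1 = 2 then (1 : L) else 0)).Local v × (UnitaryGroup.cmDatum L 1 (Matrix.of fun i j : Fin 1 => if i.val + j.val + 1 = 1 then (1 : L) else 0)).Local v) →* ℂˣ, Continuous ξ' → ¬ 𝔇.IsL2 (𝔇.piN ξ')) →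
      (∀ P ∈ 𝔇.ldsPackets, ∀ σ ∈ P, ¬ 𝔇.IsL2 σ) →
      (∀ π : IrrClass (Gqs L v), ∀ T ∈ 𝔇.cartanG, MemLp (fun t : ↥T => (𝔇.DG (t : Gqs L v) : ℂ) * 𝔇.char π (t : Gqs L v)) 2 (𝔇.μT T)) →
      (∀ ρ ∈ 𝔇.sqPacketsH, ∀ T ∈ 𝔇.cartanG, MemLp (fun t : ↥T => (𝔇.DG (t : Gqs L v) : ℂ) * 𝔇.up (𝔇.packetCharH ρ) (t : Gqs L v)) 2 (𝔇.μT T)) →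
      𝔇.cartanG ⊆ 𝔇.cartanAll →
      (∀ T ∈ 𝔇.cartanG, ∀ᵐ t : ↥T ∂(𝔇.μT T), (t : Gqs L v) ∈ 𝔇.ellG) →
      (∀ T ∈ 𝔇.cartanAll, T ∉ 𝔇.cartanG → ∀ᵐ t : ↥T ∂(𝔇.μT T), (t : Gqs L v) ∈ 𝔇.regG ∧ (t : Gqs L v) ∉ 𝔇.ellG) →
      -- ══ further datum-level sockets of ★ (R) p848976: (LDSE) (LDSU) (LDS2) (R0) (MATE-UNIQ) (ST-L2) (PI2-L2) — (SC-L2) «supercuspidal ⇒ square-integrable» is DISCHARGED below (compact centre at the non-split `v`) ══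
      (∀ P ∈ 𝔇.ldsPackets, ∀ σ ∈ P, 𝔇.IsEllipticRep σ) →
      (∀ P ∈ 𝔇.ldsPackets, ∀ π' ∈ P, ∀ π : IrrClass (Gqs L v), π ∉ P → ¬ 𝔇.IsEllipticPair π π') →
      (∀ P ∈ 𝔇.ldsPackets, ∀ σ ∈ P, ∃ σ' ∈ P, σ' ≠ σ ∧ ∀ τ ∈ P, τ = σ ∨ τ = σ') →
      (∀ P ∈ 𝔇.ldsPackets, ∀ π' ∈ P, ∀ f : Gqs L v → ℂ, 𝔇.IsPseudoCoeff π' f → ∀ fH : ((UnitaryGroup.cmDatum L 2 (Matrix.of fun i j : Fin 2 => if i.val + j.val + 1 = 2 then (1 : L) else 0)).Local v × (UnitaryGroup.cmDatum L 1 (Matrix.of fun i j : Fin 1 => if i.val + j.val + 1 = 1 then (1 : L) else 0)).Local v) → ℂ, IsLocSmooth fH → 𝔇.IsTransfer f fH →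
          (∑ σ ∈ ({πSt} : Finset (IrrClass ((UnitaryGroup.cmDatum L 2 (Matrix.of fun i j : Fin 2 => if i.val + j.val + 1 = 2 then (1 : L) else 0)).Local v × (UnitaryGroup.cmDatum L 1 (Matrix.of fun i j : Fin 1 => if i.val + j.val + 1 = 1 then (1 : L) else 0)).Local v))), σ.smoothTrace 𝔇.μH fH) = 0) →
      (∀ σ u u' : IrrClass (Gqs L v), 𝔇.IsL2 σ → ¬ 𝔇.IsL2 u → ¬ 𝔇.IsL2 u' → 𝔇.IsEllipticPair u σ → 𝔇.IsEllipticPair u' σ → u = u') →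
      (∀ ψ' : ↥(Subgroup.center (Gqs L v)) →* ℂˣ, Continuous ψ' → 𝔇.IsL2 (𝔇.stG ψ')) →
      (∀ ξ' : ((UnitaryGroup.cmDatum L 2 (Matrix.of fun i j : Fin 2 => if i.val + j.val + 1 = 2 then (1 : L) else 0)).Local v × (UnitaryGroup.cmDatum L 1 (Matrix.of fun i j : Fin 1 => if i.val + j.val + 1 = 1 then (1 : L) else 0)).Local v) →* ℂˣ, Continuous ξ' → 𝔇.IsL2 (𝔇.pi2 ξ')) →
      -- ══ THE PRINCIPAL SERIES OF THE NON-SQUARE-INTEGRABLE CLASSES [§12.2]: a parameter map `par` into the tree's PAIR currency, with (PS1) (PS2) (PS3)=(JHL) (NONL2-PAR) (UNIQ-PAR) ══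
      ∀ (par : IrrClass (Gqs L v) → (((UnitaryGroup.LocalRing L v)ˣ →* ℂˣ) × (↥(normOneUnits (conjLocal L (IsCMField.complexConj L) v)) →* ℂˣ))),
      (∀ π ∈ 𝔇.irredPS, ¬ 𝔇.IsL2 π → ∀ f : Gqs L v → ℂ, IsLocSmooth f → π.smoothTrace νQv f = Representation.smoothTrace (G := Gqs L v) (UnitaryGroup.cmPrincipalSeries L 3 v (UnitaryGroup.cmTorusCharPair L v (par π).1 (par π).2)) νQv f) →
      (∀ π σ : IrrClass (Gqs L v), ¬ 𝔇.IsL2 π → 𝔇.IsL2 σ → 𝔇.IsEllipticPair π σ → ∀ f : Gqs L v → ℂ, IsLocSmooth f →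
          π.smoothTrace νQv f + σ.smoothTrace νQv f = Representation.smoothTrace (G := Gqs L v) (UnitaryGroup.cmPrincipalSeries L 3 v (UnitaryGroup.cmTorusCharPair L v (par π).1 (par π).2)) νQv f) →
      (∀ P ∈ 𝔇.ldsPackets, ∀ π' ∈ P, ∀ π'' ∈ P, π' ≠ π'' → par π'' = par π' ∧ ∀ f : Gqs L v → ℂ, IsLocSmooth f →
          π'.smoothTrace νQv f + π''.smoothTrace νQv f = Representation.smoothTrace (G := Gqs L v) (UnitaryGroup.cmPrincipalSeries L 3 v (UnitaryGroup.cmTorusCharPair L v (par π').1 (par π').2)) νQv f) →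
      (∀ π : IrrClass (Gqs L v), ¬ 𝔇.IsL2 π →
          π.IsConstituentOf (UnitaryGroup.cmPrincipalSeries L 3 v (UnitaryGroup.cmTorusCharPair L v (par π).1 (par π).2)) ∧
            Continuous (par π).1 ∧ Continuous (par π).2) →
      (∀ u u' : IrrClass (Gqs L v), ¬ 𝔇.IsL2 u → ¬ 𝔇.IsL2 u' →
          (par u' = par u ∨ par u' = (conjInvChar (conjLocal L (IsCMField.complexConj L) v) (par u).1, (par u).2)) →
          u' = u ∨ ∃ P ∈ 𝔇.ldsPackets, u ∈ P ∧ u' ∈ P) →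
      -- ══ LH6-p05's split-torus block in place of §1's binder `hF` (★ F3′ p849140's sockets, ∀-forms) ══
      -- ══ (PSE) principal-series characters of CONTINUOUS pairs vanish against pseudo-coefficients of square-integrable classes [§12.6 p. 187] ══
      (∀ (π : IrrClass (Gqs L v)) (f : Gqs L v → ℂ), 𝔇.IsL2 π → 𝔇.IsPseudoCoeff π f → ∀ χ : (((UnitaryGroup.LocalRing L v)ˣ →* ℂˣ) × (↥(normOneUnits (conjLocal L (IsCMField.complexConj L) v)) →* ℂˣ)), Continuous χ.1 → Continuous χ.2 → Representation.smoothTrace (G := Gqs L v) (UnitaryGroup.cmPrincipalSeries L 3 v (UnitaryGroup.cmTorusCharPair L v χ.1 χ.2)) νQv f = 0) →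
      -- ══ THE SPLIT TORUS in parameter form `M = E_vˣ × E¹_v` (sockets (TOR): measurable structure, a left-invariant measure, the compact part `M_c = 𝒪ˣ × E¹`,
      --    the ray generator `a = (ϖ, 1)`: `M = M_c·a^ℤ` with pairwise disjoint shells; the W-reflection `ω = (σ(·)⁻¹, id)` preserves the measure and `M_c`) ══
      ∀ [MeasurableSpace ((UnitaryGroup.LocalRing L v)ˣ × ↥(normOneUnits (conjLocal L (IsCMField.complexConj L) v)))] [MeasurableMul ((UnitaryGroup.LocalRing L v)ˣ × ↥(normOneUnits (conjLocal L (IsCMField.complexConj L) v)))] [OpensMeasurableSpace ((UnitaryGroup.LocalRing L v)ˣ × ↥(normOneUnits (conjLocal L (IsCMField.complexConj L) v)))]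
        (μM : Measure ((UnitaryGroup.LocalRing L v)ˣ × ↥(normOneUnits (conjLocal L (IsCMField.complexConj L) v)))) [μM.IsMulLeftInvariant]
        (Mc : Subgroup ((UnitaryGroup.LocalRing L v)ˣ × ↥(normOneUnits (conjLocal L (IsCMField.complexConj L) v)))) (a : ((UnitaryGroup.LocalRing L v)ˣ × ↥(normOneUnits (conjLocal L (IsCMField.complexConj L) v)))),
        MeasurableSet (Mc : Set ((UnitaryGroup.LocalRing L v)ˣ × ↥(normOneUnits (conjLocal L (IsCMField.complexConj L) v)))) → IsCompact (Mc : Set ((UnitaryGroup.LocalRing L v)ˣ × ↥(normOneUnits (conjLocal L (IsCMField.complexConj L) v)))) → μM (Mc : Set ((UnitaryGroup.LocalRing L v)ˣ × ↥(normOneUnits (conjLocal L (IsCMField.complexConj L) v)))) < ⊤ → 0 < μM.real (Mc : Set ((UnitaryGroup.LocalRing L v)ˣ × ↥(normOneUnits (conjLocal L (IsCMField.complexConj L) v)))) →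
        Pairwise (Function.onFun Disjoint fun n : ℤ => (a ^ n) • (Mc : Set ((UnitaryGroup.LocalRing L v)ˣ × ↥(normOneUnits (conjLocal L (IsCMField.complexConj L) v))))) →
        (∀ m : ((UnitaryGroup.LocalRing L v)ˣ × ↥(normOneUnits (conjLocal L (IsCMField.complexConj L) v))), ∃ (n : ℤ) (u : ((UnitaryGroup.LocalRing L v)ˣ × ↥(normOneUnits (conjLocal L (IsCMField.complexConj L) v)))), u ∈ Mc ∧ m = a ^ n * u) →
        MeasurePreserving (fun p : ((UnitaryGroup.LocalRing L v)ˣ × ↥(normOneUnits (conjLocal L (IsCMField.complexConj L) v))) => ((Units.map ((conjLocal L (IsCMField.complexConj L) v : UnitaryGroup.LocalRing L v →+* UnitaryGroup.LocalRing L v) : UnitaryGroup.LocalRing L v →* UnitaryGroup.LocalRing L v) p.1)⁻¹, p.2)) μM μM →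
        MeasurableEmbedding (fun p : ((UnitaryGroup.LocalRing L v)ˣ × ↥(normOneUnits (conjLocal L (IsCMField.complexConj L) v))) => ((Units.map ((conjLocal L (IsCMField.complexConj L) v : UnitaryGroup.LocalRing L v →+* UnitaryGroup.LocalRing L v) : UnitaryGroup.LocalRing L v →* UnitaryGroup.LocalRing L v) p.1)⁻¹, p.2)) →
        (∀ u ∈ Mc, ((Units.map ((conjLocal L (IsCMField.complexConj L) v : UnitaryGroup.LocalRing L v →+* UnitaryGroup.LocalRing L v) : UnitaryGroup.LocalRing L v →* UnitaryGroup.LocalRing L v) u.1)⁻¹, u.2) ∈ Mc) →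
      -- ══ the torus transform `F_f` (print p. 193) and the regular hyperbolic set `Ω = G·M^reg` (posited data; their meaning is carried by the sockets below) ══
      ∀ (Ftr : (Gqs L v → ℂ) → ((UnitaryGroup.LocalRing L v)ˣ × ↥(normOneUnits (conjLocal L (IsCMField.complexConj L) v))) → ℂ) (Ω : Set (Gqs L v)),
      -- the product character of a parameter `χ = (χ₁, χ₂)` on `M = E_vˣ × E¹_v` (posited as a function, pinned by the next hypothesis)
      ∀ (toC : (((UnitaryGroup.LocalRing L v)ˣ →* ℂˣ) × (↥(normOneUnits (conjLocal L (IsCMField.complexConj L) v)) →* ℂˣ)) → (((UnitaryGroup.LocalRing L v)ˣ × ↥(normOneUnits (conjLocal L (IsCMField.complexConj L) v))) →* ℂˣ)),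
      (∀ (χ : (((UnitaryGroup.LocalRing L v)ˣ →* ℂˣ) × (↥(normOneUnits (conjLocal L (IsCMField.complexConj L) v)) →* ℂˣ))) (m : ((UnitaryGroup.LocalRing L v)ˣ × ↥(normOneUnits (conjLocal L (IsCMField.complexConj L) v)))), toC χ m = χ.1 m.1 * χ.2 m.2) →
      -- (WM∕L2M) Weyl integration on hyperbolic support for EVERY square-integrable class σ, `Θ_σ = D_G χ_σ|_M ∈ L¹(M)` [§12.5 p. 182; p. 193]
      (∀ σ : IrrClass (Gqs L v), σ.IsSquareIntegrable μZ → ∃ Θ : ((UnitaryGroup.LocalRing L v)ˣ × ↥(normOneUnits (conjLocal L (IsCMField.complexConj L) v))) → ℂ, Integrable Θ μM ∧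
          ∀ φ : Gqs L v → ℂ, IsLocSmooth φ ∧ tsupport φ ⊆ Ω → σ.smoothTrace νQv φ = ∫ m, Ftr φ m * Θ m ∂μM) →
      -- (HM) the same for the H-side `Tr St_H(ξ_v)(f^H)`, `Θ_ρ ∈ L¹(M)` [p. 193]
      (∃ Θρ : ((UnitaryGroup.LocalRing L v)ˣ × ↥(normOneUnits (conjLocal L (IsCMField.complexConj L) v))) → ℂ, Integrable Θρ μM ∧ ∀ (φ : Gqs L v → ℂ) (fH : ((UnitaryGroup.cmDatum L 2 (Matrix.of fun i j : Fin 2 => if i.val + j.val + 1 = 2 then (1 : L) else 0)).Local v × (UnitaryGroup.cmDatum L 1 (Matrix.of fun i j : Fin 1 => if i.val + j.val + 1 = 1 then (1 : L) else 0)).Local v) → ℂ), IsLocSmooth φ ∧ tsupport φ ⊆ Ω →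
          IsLocSmooth fH ∧ IsLocalDeltaTransfer L (qsForm L) v ((finExplicitCollection L (qsForm L) μ (finExplicitDelta_conj_left_all L (qsForm L) μ) (finExplicitDelta_conj_right_all L (qsForm L) μ)) v) mHv mQv fH φ → πSt.smoothTrace νHv fH = ∫ m, Ftr φ m * Θρ m ∂μM) →
      -- (PSM) van Dijk, for CONTINUOUS pairs: the character of `i_G(χ)` on hyperbolic test functions is `∫_M F_φ·(χ + wχ)` [p. 193 display; vanDijk1972]
      (∀ χ : (((UnitaryGroup.LocalRing L v)ˣ →* ℂˣ) × (↥(normOneUnits (conjLocal L (IsCMField.complexConj L) v)) →* ℂˣ)), Continuous χ.1 → Continuous χ.2 → ∀ φ : Gqs L v → ℂ, IsLocSmooth φ ∧ tsupport φ ⊆ Ω →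
          Representation.smoothTrace (G := Gqs L v) (UnitaryGroup.cmPrincipalSeries L 3 v (UnitaryGroup.cmTorusCharPair L v χ.1 χ.2)) νQv φ = (∫ m, Ftr φ m * (((toC χ) m : ℂˣ) : ℂ) ∂μM) + ∫ m, Ftr φ m * (((toC (conjInvChar (conjLocal L (IsCMField.complexConj L) v) χ.1, χ.2)) m : ℂˣ) : ℂ) ∂μM) →
      -- (SHF) on the shells `n ≠ 0`, for CONTINUOUS pairs: the W-symmetrised `η`-isotypic shell functions are torus transforms of hyperbolic test functions [p. 191 «there
      --       exists `f ∈ S` such that `F_f` has support in `η^m𝒪^* ∪ η^{−m}𝒪^*`», `m ≠ 0`; p. 194 «there exists a function f such that F_f(α) = φ(α) + φ(ᾱ⁻¹)»]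
      (∀ χ : (((UnitaryGroup.LocalRing L v)ˣ →* ℂˣ) × (↥(normOneUnits (conjLocal L (IsCMField.complexConj L) v)) →* ℂˣ)), Continuous χ.1 → Continuous χ.2 → ∀ (j : Bool) (n : ℤ), n ≠ 0 → ∃ φ : Gqs L v → ℂ, (IsLocSmooth φ ∧ tsupport φ ⊆ Ω) ∧
          Ftr φ = fun m => (((a ^ n) • (Mc : Set ((UnitaryGroup.LocalRing L v)ˣ × ↥(normOneUnits (conjLocal L (IsCMField.complexConj L) v))))).indicator (fun m => (((toC (cond j (conjInvChar (conjLocal L (IsCMField.complexConj L) v) χ.1, χ.2) χ)) a : ℂˣ) : ℂ) ^ n * ((((toC (cond j (conjInvChar (conjLocal L (IsCMField.complexConj L) v) χ.1, χ.2) χ)) m)⁻¹ : ℂˣ) : ℂ)) m) + (((a ^ n) • (Mc : Set ((UnitaryGroup.LocalRing L v)ˣ × ↥(normOneUnits (conjLocal L (IsCMField.complexConj L) v))))).indicator (fun m => (((toC (cond j (conjInvChar (conjLocal L (IsCMField.complexConj L) v) χ.1, χ.2) χ)) a : ℂˣ) : ℂ) ^ n * ((((toC (cond j (conjInvChar (conjLocal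 L (IsCMField.complexConj L) v) χ.1, χ.2) χ)) m)⁻¹ : ℂˣ) : ℂ)) ((Units.map ((conjLocal L (IsCMField.complexConj L) v : UnitaryGroup.LocalRing L v →+* UnitaryGroup.LocalRing L v) : UnitaryGroup.LocalRing L v →* UnitaryGroup.LocalRing L v) m.1)⁻¹, m.2))) →
      ∀ aX : IrrClass (Gqs L v) → ℤ, (Function.support aX).Countable →
        (∀ π : IrrClass (Gqs L v), aX π ≠ 0 → π.IsUnitarizable) →
        (∀ (fH : ((UnitaryGroup.cmDatum L 2 (Matrix.of fun i j : Fin 2 => if i.val + j.val + 1 = 2 then (1 : L) else 0)).Local v × (UnitaryGroup.cmDatum L 1 (Matrix.of fun i j : Fin 1 => if i.val + j.val + 1 = 1 then (1 : L) else 0)).Local v) → ℂ) (φ : Gqs L v → ℂ), IsLocSmooth fH → IsLocSmooth φ →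
            IsLocalDeltaTransfer L (qsForm L) v ((finExplicitCollection L (qsForm L) μ (finExplicitDelta_conj_left_all L (qsForm L) μ) (finExplicitDelta_conj_right_all L (qsForm L) μ)) v) mHv mQv fH φ →
            Summable (fun π : IrrClass (Gqs L v) => (aX π : ℂ) * π.smoothTrace νQv φ) ∧
              ∑' π : IrrClass (Gqs L v), (aX π : ℂ) * π.smoothTrace νQv φ = πSt.smoothTrace νHv fH) →
        (Function.support aX).Finite ∧ ∀ π : IrrClass (Gqs L v), aX π ≠ 0 → π.IsSquareIntegrable μZ := by
  intro L _ _ _ μ ξ v hns hμu hμω _ _ _ _ νHv νQv _ _ _ _ mHv mQv hcanH hcanQ hTv π₁ πSt hHL hπ₁ _ _ μZ _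
    𝔇 hμG hμH hμGZ hTr hρ hW hUp hPCE hPCT h61a h61b h61c hLO hEONPS hEC
    hHCH hUpReg hEll hDet hPiN hLds hL2domAll hUdom hsub hTell hTnon
    hLdsE hLdsU hLds2 hR0 hMU hStL2 hPi2L2
    par hPS1 hPS2 hPS3 hNP hUP
    hPSE _ _ _ μM _ Mc a hMc hMccpt hMcfin hMcpos hdisj hgen hωpres hωemb hωMc Ftr Ω toC htoC hWM hHM hPSM hSHF
    aX hcnt hunit hid
  -- the organ's quotient σ-algebras, re-installed as local instances
  letI : ∀ a' : ((UnitaryGroup.cmDatum L 2 (Matrix.of fun i j : Fin 2 => if i.val + j.val + 1 = 2 then (1 : L) else 0)).Local v × (UnitaryGroup.cmDatum L 1 (Matrix.of fun i j : Fin 1 => if i.val + j.val + 1 = 1 then (1 : L) else 0)).Local v), MeasurableSpace (((UnitaryGroup.cmDatum L 2 (Matrix.of fun i j : Fin 2 => if i.val + j.val + 1 = 2 then (1 : L) else 0)).Local v × (UnitaryGroup.cmDatum L 1 (Matrix.of fun i j : Fin 1 => if i.val + j.val + 1 = 1 then (1 : L) else 0)).Local v) ⧸ Subgroup.centralizer ({a'}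 : Set ((UnitaryGroup.cmDatum L 2 (Matrix.of fun i j : Fin 2 => if i.val + j.val + 1 = 2 then (1 : L) else 0)).Local v × (UnitaryGroup.cmDatum L 1 (Matrix.of fun i j : Fin 1 => if i.val + j.val + 1 = 1 then (1 : L) else 0)).Local v))) := fun _ => borel _
  haveI : ∀ a' : ((UnitaryGroup.cmDatum L 2 (Matrix.of fun i j : Fin 2 => if i.val + j.val + 1 = 2 then (1 : L) else 0)).Local v × (UnitaryGroup.cmDatum L 1 (Matrix.of fun i j : Fin 1 => if i.val + j.val + 1 = 1 then (1 : L) else 0)).Local v), BorelSpace (((UnitaryGroup.cmDatum L 2 (Matrix.of fun i j : Fin 2 => if i.val + j.val + 1 = 2 then (1 : L) else 0)).Local v × (UnitaryGroup.cmDatum L 1 (Matrix.of fun i j : Fin 1 => if i.val + j.val + 1 = 1 then (1 : L) else 0)).Local v) ⧸ Subgroup.centralizer ({a'} : Set ((UnitaryGroup.cmDatum L 2 (Matrix.of fun i j : Fin 2 => if i.val + j.val + 1 = 2 then (1 : L) else 0)).Local v × (UnitaryGroup.cmDatum L 1 (Matrix.of fun i j : Fin 1 => if i.val + j.val + 1 =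 1 then (1 : L) else 0)).Local v))) := fun _ => ⟨rfl⟩
  letI : ∀ γ : Gqs L v, MeasurableSpace (Gqs L v ⧸ Subgroup.centralizer ({γ} : Set (Gqs L v))) := fun _ => borel _
  haveI : ∀ γ : Gqs L v, BorelSpace (Gqs L v ⧸ Subgroup.centralizer ({γ} : Set (Gqs L v))) := fun _ => ⟨rfl⟩
  exact stSupportFiniteSqInt_of_carpet_of_F L μ ξ v hns hμu hμω νHv νQv mHv mQv hcanH hcanQ hTv π₁ πSt hHL hπ₁ μZ
      𝔇 hμG hμH hμGZ hTr hρ hW hUp hPCE hPCT h61a h61b h61c hLO hEONPS hEC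
      hHCH hUpReg hEll hDet hPiN hLds hL2domAll hUdom hsub hTell hTnon hLdsE hLdsU hLds2 hR0 hMU hStL2 hPi2L2 par hPS1 hPS2 hPS3 hNP hUP
      (fun b d hbL2 hWred hcont hidn hex =>
        F0P3cStCharTSSaTorusNZ.false_of_saRegroup_disjunct_of_ne_zero L μ ξ v hns hμu hμω νHv νQv mHv mQv hcanH hcanQ hTv π₁ πSt hHL hπ₁ μZ
      𝔇 hμG hμH hμGZ hTr hρ hW hUp hPCE hPCT h61a h61b h61c hHCH hUpReg hEll hDet hPiN hLds hL2domAll hUdom hsub hTell hTnon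
          b d hbL2 hWred hcont hidn hex (fun π f hπ hf χ hχ => hPSE π f hπ hf χ (hcont χ hχ).1 (hcont χ hχ).2)
          μM Mc a hMc hMccpt hMcfin hMcpos hdisj hgen hωpres hωemb hωMc Ftr Ω toC htoC
          (fun σ hσ => hWM σ (hbL2 σ hσ)) hHM (fun χ hχ => hPSM χ (hcont χ hχ).1 (hcont χ hχ).2)
          (fun χ hχ j n hn => hSHF χ (hcont χ hχ).1 (hcont χ hχ).2 j n hn))
      aX hcnt hunit hid

end Summit.HodgeConjecture.HodgeConjecture.Cruxes.H413.F0P3cStCharTSSaHead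

end
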